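import Summits.QuantumFields.QCD.Theses.QuarksAsStableAction
import Summits.QuantumFields.QCD.Theorems.QuarksAsStableActionStableActionBridgeDefectBound

/-!
# The free-patch Sylvester bound in terms of the number of non-trivial links
(crux `QuarksAsStableAction.StableActionBridge`, item stmt-QuantumFields-9737, line `Sketch`; lead helper of
continuation lead c2, cycle 3, `--supports stmt-QuantumFields-9737`; card `sylvester-defect-floor`)

`free_patch_defect_bound` (p114014) controls the antiperiodic Wilson-quark determinant of an `SU(3)` field `U`
against the free one by `(1 + κ√|Z̄(U)|)^{|Z̄(U)|}`, where `Z̄(U)` is the set of quark indices (site × colour × spin)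
whose site touches a non-trivial link.  Here the defect set is counted by LINKS: every non-trivial link `e`
contributes at most its two endpoints, each carrying `3 · 4 = 12` colour–spin indices, so `|Z̄(U)| ≤ 24 · n(U)` with
`n(U) = #{e | U e ≠ 1}` (`card_defectSet_le`), and since `x ↦ (1 + κ√x)^x` is monotone,

  `‖apDet U m‖ ≤ (1 + κ √(24 n(U)))^{24 n(U)} · ‖apDet 𝟙 m‖`   (`free_patch_defect_bound_links`)

for `L ≥ 2`, `m ∈ [−1/2, 1]`, uniformly in the volume: the determinant grows at most like `exp(c · n log(2 + n))` in
the number `n` of links where the field is switched on — the bare-scale, gauge-variant shadow of the action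
functionals in `WilsonQuarkStability`.  Finite combinatorics on top of p114014; no definitions.
-/

namespace Summit.QuantumFields.QCD.Cruxes.StableActionBridge.Sketch

open Literature.MathematicalPhysics.QuantumLattice Literature.MathematicalPhysics.QuantumFieldTheory
open Literature.Probability.LatticeModels (TorusSite)

/-! ### Counting the defect set by links -/

open Classical in
/-- **Defect indices versus defect links.**  The quark indices whose site touches a non-trivial link are at most
`24` times the number of non-trivial links (two endpoints per link, `3 · 4` colour–spin indices per site). -/
theorem card_defectSet_le {L : ℕ} [NeZero L] (U : GaugeConfig 4 L (Matrix.specialUnitaryGroup (Fin 3) ℂ)) :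
    (Finset.univ.filter fun p : TorusSite 4 L × Fin 3 × Fin 4 =>
        (∃ μ : Fin 4, U (p.1, μ) ≠ 1) ∨ (∃ μ : Fin 4, U (p.1 - Pi.single μ 1, μ) ≠ 1)).card ≤
      24 * (Finset.univ.filter fun e : Edge 4 L => U e ≠ 1).card := by
  set Bad : Finset (Edge 4 L) := Finset.univ.filter fun e : Edge 4 L => U e ≠ 1 with hBad
  -- bad sites: the two endpoints of the bad links
  set S : Finset (TorusSite 4 L) := Bad.image (fun e => e.1) ∪ Bad.image (fun e => e.1 + Pi.single e.2 1)
    with hS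
  have hScard : S.card ≤ 2 * Bad.card := by
    calc S.card ≤ (Bad.image fun e => e.1).card + (Bad.image fun e => e.1 + Pi.single e.2 1).card :=
          Finset.card_union_le _ _
      _ ≤ Bad.card + Bad.card := add_le_add Finset.card_image_le Finset.card_image_le
      _ = 2 * Bad.card := by ring
  -- the defect set sits inside `S × colour × spin`
  have hsub : (Finset.univ.filter fun p : TorusSite 4 L × Fin 3 × Fin 4 =>
      (∃ μ : Fin 4, U (p.1, μ) ≠ 1) ∨ (∃ μ : Fin 4, U (p.1 - Pi.single μ 1, μ) ≠ 1)) ⊆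
      S ×ˢ (Finset.univ : Finset (Fin 3 × Fin 4)) := by
    intro p hp
    rw [Finset.mem_filter] at hp
    rw [Finset.mem_product]
    refine ⟨?_, Finset.mem_univ _⟩
    rcases hp.2 with ⟨μ, hμ⟩ | ⟨μ, hμ⟩
    · exact Finset.mem_union_left _ (Finset.mem_image.2 ⟨(p.1, μ), by simp [hBad, hμ], rfl⟩)
    · refine Finset.mem_union_right _ (Finset.mem_image.2 ⟨(p.1 - Pi.single μ 1, μ), by simp [hBad, hμ], ?_⟩)
      exact sub_add_cancel p.1 (Pi.single μ 1)
  calc _ ≤ (S ×ˢ (Finset.univ : Finset (Fin 3 × Fin 4))).card := Finset.card_le_card hsub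
    _ = S.card * 12 := by
        rw [Finset.card_product, Finset.card_univ, Fintype.card_prod, Fintype.card_fin, Fintype.card_fin]
    _ ≤ 2 * Bad.card * 12 := Nat.mul_le_mul_right 12 hScard
    _ = 24 * Bad.card := by ring

/-- Monotonicity of `x ↦ (1 + κ√x)^x` on `ℕ` for `κ ≥ 0`. -/
theorem one_add_mul_sqrt_pow_mono {κ : ℝ} (hκ : 0 ≤ κ) {a b : ℕ} (hab : a ≤ b) :
    (1 + κ * Real.sqrt (a : ℝ)) ^ a ≤ (1 + κ * Real.sqrt (b : ℝ)) ^ b := by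
  have hb1 : (1 : ℝ) ≤ 1 + κ * Real.sqrt (b : ℝ) := le_add_of_nonneg_right (by positivity)
  have hab' : (a : ℝ) ≤ (b : ℝ) := by exact_mod_cast hab
  have hsqrt : Real.sqrt (a : ℝ) ≤ Real.sqrt (b : ℝ) := Real.sqrt_le_sqrt hab'
  have hbase : 1 + κ * Real.sqrt (a : ℝ) ≤ 1 + κ * Real.sqrt (b : ℝ) := by nlinarith
  calc (1 + κ * Real.sqrt (a : ℝ)) ^ a ≤ (1 + κ * Real.sqrt (b : ℝ)) ^ a :=
        pow_le_pow_left₀ (by positivity) hbase a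
    _ ≤ (1 + κ * Real.sqrt (b : ℝ)) ^ b := pow_le_pow_right₀ hb1 hab

open Classical in
/-- **The free-patch Sylvester bound counted by links** (registered sub-goal `free_patch_defect_bound_links` of crux
stmt-QuantumFields-9737).  There is `κ ≥ 0` such that for every `L ≥ 2`, every bare mass `m ∈ [−1/2, 1]` and every
`SU(3)` gauge field `U` on `(ℤ/L)⁴`, with `n = #{e | U e ≠ 1}` the number of non-trivial links,
`‖apDet U m‖ ≤ (1 + κ √(24 n))^{24 n} · ‖apDet 𝟙 m‖` (`apDet` exactly as in `WilsonQuarkStability`). -/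
theorem free_patch_defect_bound_links :
    ∃ κ : ℝ, 0 ≤ κ ∧ ∀ (L : ℕ) [NeZero L], 2 ≤ L → ∀ m : ℝ, -(1 / 2 : ℝ) ≤ m → m ≤ 1 →
      ∀ U : GaugeConfig 4 L (Matrix.specialUnitaryGroup (Fin 3) ℂ),
        let apDet : GaugeConfig 4 L (Matrix.specialUnitaryGroup (Fin 3) ℂ) → ℝ → ℂ := fun U m =>
          fermionDet (wilsonDirac (unitaryFundamentalRep (Fin 3) ℂ)
            (fun e => if e.1 e.2 = -1
              then -(⟨(U e).1, Matrix.specialUnitaryGroup_le_unitaryGroup (U e).2⟩ :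
                Matrix.unitaryGroup (Fin 3) ℂ)
              else ⟨(U e).1, Matrix.specialUnitaryGroup_le_unitaryGroup (U e).2⟩) m 1);
        let n : ℕ := (Finset.univ.filter fun e : Edge 4 L => U e ≠ 1).card;
        ‖apDet U m‖ ≤ (1 + κ * Real.sqrt ((24 * n : ℕ) : ℝ)) ^ (24 * n) * ‖apDet 1 m‖ := by
  obtain ⟨κ, hκ, hmain⟩ := free_patch_defect_bound
  refine ⟨κ, hκ, ?_⟩
  intro L _ hL m hm0 hm1 U apDet n
  have h := hmain L hL m hm0 hm1 U
  dsimp only at h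
  have hcard := card_defectSet_le U
  calc ‖apDet U m‖ ≤ _ := h
    _ ≤ (1 + κ * Real.sqrt ((24 * n : ℕ) : ℝ)) ^ (24 * n) * ‖apDet 1 m‖ :=
        mul_le_mul_of_nonneg_right (one_add_mul_sqrt_pow_mono hκ hcard) (norm_nonneg _)

end Summit.QuantumFields.QCD.Cruxes.StableActionBridge.Sketch
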